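import Literature.NumberTheory.DiophantineGeometry.GenEllDeFamilyDefectCofactor
import Literature.NumberTheory.DiophantineGeometry.GenEllDeCritDivisibility
import HarnessLib

/-!
# [GenEll] Thm. 2.1 on the `D_e` route, family `t_c`: the bad-place defect inequality from the critical
# values alone (junction `(S1) ∘ (F-b)` of the abc-iut cell's R-b chain)

S. Mochizuki, *Arithmetic elliptic curves in general position*, Math. J. Okayama Univ. **52** (2010),
Prop. 1.6 p. 10 / proof of Thm. 2.1 pp. 12–13 [cite: MochizukiGenEll2010, Prop 1.6 p.10]; support file
for the route item `GenEllTwo` (stmt-ABC-19679), ruling #7 «R-b with defects».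

One-step junction of the two halves of the R-b bad-place input:
* `DeC.exists_prod_fibre_eq_N_mul` (abc-iut-w5-d054, `GenEllDeCritDivisibility`): for `c ≠ 0`, `R_c`
  split in the number field `K` and `A ⊂ K` containing every critical value `tCritC k c θ`, the identity
  `∏_{a∈A} (s + c·r^{k+2} − a·rs) = N_c·(H₀(r) + H₁(r)·s)` at every point of `D_e` in every `K`-algebra;
* `DeC.exists_defect_of_cofactor_polys` (abc-iut-w5-d241, `GenEllDeFamilyDefectCofactor`): such an
  identity yields ONE integer `D ≥ 1` with
  `ord⁺_w N_c ≤ Σ_{a∈A} ord⁺_w (t − a) + ord_w D + Σ_{a∈A} (−ord_w a)⁺` at every finite place `w` of every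
  number field `L ⊇ K` with `w(2) = w(c) = 1`, for every point with `N_c ≠ 0`, `t ∉ A`.

Hence `DeC.exists_defect_of_critValues`: the defect inequality from ONLY «`c ≠ 0`, `R_c` splits in `K`,
`A ∋` the critical values» — no separation, no good reduction, no `hconv`, no cofactor hypothesis.
Theorems only; classical; nothing here bears on [IUTchIII] Cor. 3.12.
-/

noncomputable section

namespace Literature.NumberTheory.DiophantineGeometry.GenEll

open _root_.Polynomial NumberField IsDedekindDomain
open Literature.IUT.LogVolume

universe u

variable (k : ℕ) {K : Type u} [Field K] [NumberField K]

/-- **The R-b bad-place defect inequality from the critical values alone.**  For `c ≠ 0`, `R_c` split in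
the number field `K` and a finite `A ⊂ K` containing every critical value `tCritC k c θ` (`θ` the roots of
`R_c`), there is ONE integer `D ≥ 1` such that at every finite place `w` of every number field `L ⊇ K`
with `w(2) = w(c) = 1`, every point `(r, s, t)` of `D_e` (`s² = 1 − 4r^{2k+1}`, `t·(rs) = s + c·r^{k+2}`)
with `N_c ≠ 0`, `t ∉ A` satisfies
`ord⁺_w N_c ≤ Σ_{a∈A} ord⁺_w (t − a) + ord_w D + Σ_{a∈A} (−ord_w a)⁺`.
[cite: MochizukiGenEll2010, Prop 1.6 p.10] -/
theorem DeC.exists_defect_of_critValues {c : K} (hc : c ≠ 0) (A : Finset K)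
    (hsplit : (DeCrit.RpolyC k c).Splits)
    (hA : ∀ θ : K, (DeCrit.RpolyC k c).eval θ = 0 → DeCrit.tCritC k c θ ∈ A) :
    ∃ D : ℕ, D ≠ 0 ∧ ∀ (L : Type u) [Field L] [NumberField L] [Algebra K L]
      (w : HeightOneSpectrum (𝓞 L)), w.valuation L 2 = 1 → w.valuation L (algebraMap K L c) = 1 →
      ∀ (r s t N : L), s ^ 2 = 1 - 4 * r ^ (2 * k + 1) →
        t * (r * s) = s + algebraMap K L c * r ^ (k + 2) →
        N = -s ^ 3 + algebraMap K L c * ((k + 1) * r ^ (k + 2) - 2 * r ^ (3 * k + 3)) → N ≠ 0 →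
        (∀ a ∈ A, t ≠ algebraMap K L a) →
        (ord L w N).toNat ≤
          (∑ a ∈ A, (ord L w (t - algebraMap K L a)).toNat) + (ord L w (D : L)).toNat +
            ∑ a ∈ A, (-ord L w (algebraMap K L a)).toNat := by
  obtain ⟨H₀, H₁, hH⟩ := DeC.exists_prod_fibre_eq_N_mul (K := K) k hc A hsplit hA
  exact DeC.exists_defect_of_cofactor_polys k c A H₀ H₁ hH

/-- The same with the critical-value hypothesis in the `hcritB` shape of abc-iut-w5-d059's
`DeCrit.forall_root_tC_mem_of_critSetC_subset_image` (the value `t_c(Q_θ)` written out).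
[cite: MochizukiGenEll2010, Prop 1.6 p.10] -/
theorem DeC.exists_defect_of_critValues' {c : K} (hc : c ≠ 0) (A : Finset K)
    (hsplit : (DeCrit.RpolyC k c).Splits)
    (hcritB : ∀ θ : K, (DeCrit.RpolyC k c).eval θ = 0 →
      ((1 - 2 * DeCrit.critXC k c θ) + c * θ ^ (k + 2)) / (θ * (1 - 2 * DeCrit.critXC k c θ)) ∈ A) :
    ∃ D : ℕ, D ≠ 0 ∧ ∀ (L : Type u) [Field L] [NumberField L] [Algebra K L]
      (w : HeightOneSpectrum (𝓞 L)), w.valuation L 2 = 1 → w.valuation L (algebraMap K L c) = 1 →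
      ∀ (r s t N : L), s ^ 2 = 1 - 4 * r ^ (2 * k + 1) →
        t * (r * s) = s + algebraMap K L c * r ^ (k + 2) →
        N = -s ^ 3 + algebraMap K L c * ((k + 1) * r ^ (k + 2) - 2 * r ^ (3 * k + 3)) → N ≠ 0 →
        (∀ a ∈ A, t ≠ algebraMap K L a) →
        (ord L w N).toNat ≤
          (∑ a ∈ A, (ord L w (t - algebraMap K L a)).toNat) + (ord L w (D : L)).toNat +
            ∑ a ∈ A, (-ord L w (algebraMap K L a)).toNat := by
  refine DeC.exists_defect_of_critValues k hc A hsplit fun θ hθ => ?_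
  rw [← DeCrit.tC_critPointC two_ne_zero]
  exact hcritB θ hθ

/-- **Integral critical values**: at a place where moreover every `a ∈ A` is `w`-integral (all but
finitely many places of `L`, the exceptions lying over a finite set of primes depending only on `A ⊂ K`),
the pole term vanishes: `ord⁺_w N_c ≤ Σ_{a∈A} ord⁺_w (t − a) + ord_w D`.
[cite: MochizukiGenEll2010, Prop 1.6 p.10] -/
theorem DeC.exists_defect_of_critValues_integral {c : K} (hc : c ≠ 0) (A : Finset K)
    (hsplit : (DeCrit.RpolyC k c).Splits)
    (hA : ∀ θ : K, (DeCrit.RpolyC k c).eval θ = 0 → DeCrit.tCritC k c θ ∈ A) :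
    ∃ D : ℕ, D ≠ 0 ∧ ∀ (L : Type u) [Field L] [NumberField L] [Algebra K L]
      (w : HeightOneSpectrum (𝓞 L)), w.valuation L 2 = 1 → w.valuation L (algebraMap K L c) = 1 →
      (∀ a ∈ A, w.valuation L (algebraMap K L a) ≤ 1) →
      ∀ (r s t N : L), s ^ 2 = 1 - 4 * r ^ (2 * k + 1) →
        t * (r * s) = s + algebraMap K L c * r ^ (k + 2) →
        N = -s ^ 3 + algebraMap K L c * ((k + 1) * r ^ (k + 2) - 2 * r ^ (3 * k + 3)) → N ≠ 0 →
        (∀ a ∈ A, t ≠ algebraMap K L a) →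
        (ord L w N).toNat ≤
          (∑ a ∈ A, (ord L w (t - algebraMap K L a)).toNat) + (ord L w (D : L)).toNat := by
  obtain ⟨D, hD, h⟩ := DeC.exists_defect_of_critValues k hc A hsplit hA
  refine ⟨D, hD, fun L _ _ _ w hv2 hcv hAint r s t N hcurve ht hN hN0 htA => ?_⟩
  have hmain := h L w hv2 hcv r s t N hcurve ht hN hN0 htA
  have hzero : ∑ a ∈ A, (-ord L w (algebraMap K L a)).toNat = 0 :=
    Finset.sum_eq_zero fun a ha =>
      Int.toNat_eq_zero.mpr (by have := ord_nonneg_of_valuation_le_one w (hAint a ha); omega)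
  omega

end Literature.NumberTheory.DiophantineGeometry.GenEll
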